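import Summits.CriticalPhenomena.SAWScalingLimit.Theorems.SAWDevelopingMapObservableToSLECanonicalTransferFamily
import HarnessLib

/-!
# Two-piece flat domains: flat windows and the push-down of the exterior under them
# (piece (G4′a) of stub 5a4′ `stub_carvedReduction_squeeze`)

Piece of stub 5a4′ `stub_carvedReduction_squeeze` (`TwoPieceAdmRestrictionLimit → MovingCarvingSqueeze`)
of the line `bridge-gate-renewal` (r9) of the crux `SAWDefectDecoherence.ObservableToSLER`
(stmt-CriticalPhenomena-14005; twin T2b′/T2b″ of stmt-CriticalPhenomena-10472), item (G4′):
ADMISSIBLE LATTICE FAMILIES OF A TWO-PIECE FLAT DOMAIN.  Both `MovingCarvingSqueeze` (for the fixed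
inner domain `M`) and every application of ARL″ (`TwoPieceAdmRestrictionLimit`, for the pairs
outer approximant / inner domain) ask for vertex domains `Λ δ` which are simply connected and
connected, lie inside the domain, have EXACT rows `{row ≥ mᵢ δ}` in balls about the two marked
points, prescribed vertical gate mid-edges, and exhaust the compacts.  The floor line's tools
(`FloorRatio.exists_innerFamily` and its companions, crux 10472) do this for FLOOR domains
`Ω ⊆ {im > h}` with both marked points on the line `im = h`; the squeeze needs it for a general
bounded domain with connected exterior which is flat (an exact upper half-disc) in the `ρ`-balls
about two boundary points `p 0`, `p 1` at DIFFERENT heights, with PRESCRIBED threshold rows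
`m i` (at the un-pinned end the translated gate row may sit many rows above the natural one).

This file is the continuum input of that construction.  The deep vertices `S` at mesh `δ` will
be: `δ c_u ∈ Ω`, row `≥ m i δ` inside `B(p i, ρ/2)`, and the closed `70δ`-disc about `δ c_u`
inside `Ω ∪ B(p 0, 5ρ/8) ∪ B(p 1, 5ρ/8)` (the absorbing discs let the exact rows reach the flat
boundary pieces).  The escape routes of the non-deep vertices follow exterior paths, which may skim
the flat pieces from below, next to deep vertices just above the line; so the exterior is first
pushed down, inside the two window boxes only, by a continuous map of the plane:

* `not_mem_closure_of_flat`, `im_lt_of_flat`, `im_lt_of_flat_of_exterior`,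
  `center_mem_closure_of_flat` — elementary facts about a flat window;
* `exists_pushDown` — the push-down map (continuous, exterior into exterior, identity off the
  upper parts of the window boxes, and pushed exterior points absorbed by a disc `B(p j, 5ρ/8)`
  lie at height `≤ im (p j) - 30δ`).

Sources: H. Duminil-Copin, S. Smirnov, Ann. of Math. 175 (2012) §3; G. F. Lawler, O. Schramm,
W. Werner, Proc. Sympos. Pure Math. 72 (2004) §3.4.
-/
noncomputable section
open scoped Topology
open Filter Set Metric
open Literature.Probability.LatticeModels (HexVertex hexGraph hexCenter Site)
open Literature.Probability.RandomPlanarGeometry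
open Literature.Probability.RandomPlanarGeometry.SAW
open Literature.Probability.Percolation (PathIn)

namespace Summit.CriticalPhenomena.SAWScalingLimit.Theorems.ObservableToSLER.Squeeze

open Summit.CriticalPhenomena.SAWScalingLimit.Theorems.ObservableToSLE.FloorRatio

/-! ### Flat windows: elementary facts -/

/-- Below a flat window there is no point of `closure Ω`. -/
theorem not_mem_closure_of_flat {Ω : Set ℂ} {q : ℂ} {ρ : ℝ}
    (hfl : Ω ∩ ball q ρ = {z : ℂ | q.im < z.im} ∩ ball q ρ) {w : ℂ} (hw : w ∈ ball q ρ)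
    (hwim : w.im < q.im) : w ∉ closure Ω := by
  intro hwc
  have hopen : IsOpen (ball q ρ ∩ {z : ℂ | z.im < q.im}) :=
    isOpen_ball.inter (isOpen_lt Complex.continuous_im continuous_const)
  obtain ⟨z, hzU, hzΩ⟩ := mem_closure_iff.1 hwc _ hopen ⟨hw, hwim⟩
  have : z ∈ Ω ∩ ball q ρ := ⟨hzΩ, hzU.1⟩
  rw [hfl] at this
  have h1 : q.im < z.im := this.1
  have h2 : z.im < q.im := hzU.2
  exact lt_irrefl _ (h1.trans h2)

/-- Inside a flat window, points of `Ω` lie strictly above the line. -/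
theorem im_lt_of_flat {Ω : Set ℂ} {q : ℂ} {ρ : ℝ}
    (hfl : Ω ∩ ball q ρ = {z : ℂ | q.im < z.im} ∩ ball q ρ) {w : ℂ} (hw : w ∈ ball q ρ)
    (hwΩ : w ∈ Ω) : q.im < w.im := by
  have : w ∈ Ω ∩ ball q ρ := ⟨hwΩ, hw⟩
  rw [hfl] at this
  exact this.1

/-- Inside a flat window, exterior points lie strictly below the line. -/
theorem im_lt_of_flat_of_exterior {Ω : Set ℂ} {q : ℂ} {ρ : ℝ}
    (hfl : Ω ∩ ball q ρ = {z : ℂ | q.im < z.im} ∩ ball q ρ) {w : ℂ} (hw : w ∈ ball q ρ)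
    (hwE : w ∉ closure Ω) : w.im < q.im := by
  by_contra hge
  push Not at hge
  apply hwE
  -- `w` is a limit of the points `w + it`, `t ↓ 0`, which lie in the window above the line
  rw [Metric.mem_closure_iff]
  intro ε hε
  have hwρ : dist w q < ρ := mem_ball.1 hw
  set t : ℝ := min (ε / 2) ((ρ - dist w q) / 2) with ht
  have ht0 : 0 < t := lt_min (half_pos hε) (by linarith)
  refine ⟨w + (t : ℂ) * Complex.I, ?_, ?_⟩
  · have hmem : w + (t : ℂ) * Complex.I ∈ {z : ℂ | q.im < z.im} ∩ ball q ρ := by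
      refine ⟨?_, ?_⟩
      · show q.im < (w + (t : ℂ) * Complex.I).im
        simp only [Complex.add_im, Complex.mul_im, Complex.ofReal_re, Complex.I_im, mul_one,
          Complex.ofReal_im, Complex.I_re, mul_zero, add_zero]
        linarith
      · rw [mem_ball]
        calc dist (w + (t : ℂ) * Complex.I) q ≤ dist (w + (t : ℂ) * Complex.I) w + dist w q :=
              dist_triangle _ _ _
          _ = t + dist w q := by
              rw [dist_eq_norm, add_sub_cancel_left, norm_mul, Complex.norm_real, Complex.norm_I,
                mul_one, Real.norm_of_nonneg ht0.le]
          _ < ρ := by have := min_le_right (ε / 2) ((ρ - dist w q) / 2); linarith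
    rw [← hfl] at hmem
    exact hmem.1
  · rw [dist_comm, dist_eq_norm, add_sub_cancel_left, norm_mul, Complex.norm_real, Complex.norm_I,
      mul_one, Real.norm_of_nonneg ht0.le]
    have := min_le_left (ε / 2) ((ρ - dist w q) / 2)
    linarith

/-- The centre of a flat window lies in `closure Ω`. -/
theorem center_mem_closure_of_flat {Ω : Set ℂ} {q : ℂ} {ρ : ℝ} (hρ : 0 < ρ)
    (hfl : Ω ∩ ball q ρ = {z : ℂ | q.im < z.im} ∩ ball q ρ) : q ∈ closure Ω := by
  by_contra h
  exact lt_irrefl _ (im_lt_of_flat_of_exterior hfl (mem_ball_self hρ) h)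

/-! ### Pushing the exterior down under the windows -/

/-- **The push-down map.**  Let `Ω` be flat in the `ρ`-balls about `p 0`, `p 1`
(`dist (p 0) (p 1) ≥ 2ρ`, `1000δ ≤ ρ`).  There is a continuous map `Pd` of the plane which
(i) maps the exterior `(closure Ω)ᶜ` into itself, (ii) fixes every point which, if within `7ρ/10`
of a window centre `p i`, lies at height `≤ im (p i) - ρ/8` (in particular every point outside
`B(p 0, 7ρ/10) ∪ B(p 1, 7ρ/10)`), and (iii) sends exterior points into the complement of the two
slabs: an exterior point whose image lies in `B(p j, 5ρ/8)` has image at height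
`≤ im (p j) - 30δ`.  (`Pd z = z - i σ(z)`, `σ` a product of plateau functions of `re z` and
`im z` supported in the window boxes, equal to `31δ` right under the flat pieces.) -/
theorem exists_pushDown {Ω : Set ℂ} {ρ δ : ℝ} {p : Fin 2 → ℂ}
    (hfl : ∀ i, Ω ∩ ball (p i) ρ = {z : ℂ | (p i).im < z.im} ∩ ball (p i) ρ)
    (hsep : 2 * ρ ≤ dist (p 0) (p 1)) (hρ : 0 < ρ) (hδ : 0 < δ) (hδρ : 1000 * δ ≤ ρ) :
    ∃ Pd : ℂ → ℂ, Continuous Pd ∧ (∀ z, z ∉ closure Ω → Pd z ∉ closure Ω) ∧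
      (∀ z : ℂ, (∀ i, dist z (p i) < 7 * ρ / 10 → z.im ≤ (p i).im - ρ / 8) → Pd z = z) ∧
      (∀ z, z ∉ closure Ω → ∀ j, Pd z ∈ ball (p j) (5 * ρ / 8) → (Pd z).im ≤ (p j).im - 30 * δ) := by
  -- the push profiles
  set sfun : Fin 2 → ℝ → ℝ := fun i x =>
    31 * δ * max 0 (min 1 ((5 * ρ / 8 + 62 * δ - |x - (p i).re|) / (31 * δ)))
  set tfun : Fin 2 → ℝ → ℝ := fun i y =>
    max 0 (min 1 (min ((y - ((p i).im - ρ / 8)) / (ρ / 8 - 35 * δ)) (((p i).im + ρ / 8 - y) / (ρ / 8))))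
  set σ : ℂ → ℝ := fun z => sfun 0 z.re * tfun 0 z.im + sfun 1 z.re * tfun 1 z.im
  set Pd : ℂ → ℂ := fun z => z - ((σ z : ℝ) : ℂ) * Complex.I with hPd
  have h31 : 0 < 31 * δ := by positivity
  have hρ8 : 0 < ρ / 8 - 35 * δ := by linarith
  have hs_nn : ∀ i x, 0 ≤ sfun i x := fun i x => mul_nonneg h31.le (le_max_left _ _)
  have hs_le : ∀ i x, sfun i x ≤ 31 * δ := fun i x => by
    have : max 0 (min 1 ((5 * ρ / 8 + 62 * δ - |x - (p i).re|) / (31 * δ))) ≤ 1 :=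
      max_le zero_le_one (min_le_left _ _)
    calc sfun i x = 31 * δ * max 0 (min 1 ((5 * ρ / 8 + 62 * δ - |x - (p i).re|) / (31 * δ))) := rfl
      _ ≤ 31 * δ * 1 := mul_le_mul_of_nonneg_left this h31.le
      _ = 31 * δ := mul_one _
  have ht_nn : ∀ i y, 0 ≤ tfun i y := fun i y => le_max_left _ _
  have ht_le : ∀ i y, tfun i y ≤ 1 := fun i y => max_le zero_le_one (min_le_left _ _)
  have hs_pos : ∀ i x, 0 < sfun i x → |x - (p i).re| < 5 * ρ / 8 + 62 * δ := by
    intro i x hx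
    by_contra hle
    push Not at hle
    have : max 0 (min 1 ((5 * ρ / 8 + 62 * δ - |x - (p i).re|) / (31 * δ))) = 0 :=
      max_eq_left ((min_le_right _ _).trans (div_nonpos_of_nonpos_of_nonneg (by linarith) h31.le))
    have h0 : sfun i x = 0 := by
      show 31 * δ * max 0 (min 1 ((5 * ρ / 8 + 62 * δ - |x - (p i).re|) / (31 * δ))) = 0
      rw [this, mul_zero]
    exact hx.ne' h0
  have hs_eq : ∀ i x, |x - (p i).re| < 5 * ρ / 8 + 31 * δ → sfun i x = 31 * δ := by
    intro i x hx
    have h1 : 1 ≤ (5 * ρ / 8 + 62 * δ - |x - (p i).re|) / (31 * δ) := by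
      rw [le_div_iff₀ h31]; linarith
    show 31 * δ * max 0 (min 1 ((5 * ρ / 8 + 62 * δ - |x - (p i).re|) / (31 * δ))) = 31 * δ
    rw [min_eq_left h1, max_eq_right zero_le_one, mul_one]
  have ht_pos : ∀ i y, 0 < tfun i y → |y - (p i).im| < ρ / 8 := by
    intro i y hy
    have h1 : 0 < min 1 (min ((y - ((p i).im - ρ / 8)) / (ρ / 8 - 35 * δ))
        (((p i).im + ρ / 8 - y) / (ρ / 8))) := by
      by_contra hle
      push Not at hle
      have : tfun i y = 0 := max_eq_left hle
      exact hy.ne' this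
    have h2 := (lt_min_iff.1 h1).2
    obtain ⟨hA, hB⟩ := lt_min_iff.1 h2
    have hA' : 0 < y - ((p i).im - ρ / 8) := by
      rcases lt_or_ge 0 (y - ((p i).im - ρ / 8)) with h | h
      · exact h
      · exact absurd hA (not_lt.2 (div_nonpos_of_nonpos_of_nonneg h hρ8.le))
    have hB' : 0 < (p i).im + ρ / 8 - y := by
      rcases lt_or_ge 0 ((p i).im + ρ / 8 - y) with h | h
      · exact h
      · exact absurd hB (not_lt.2 (div_nonpos_of_nonpos_of_nonneg h (by positivity)))
    rw [abs_sub_lt_iff]; constructor <;> linarith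
  have ht_one : ∀ i y, (p i).im - 35 * δ ≤ y → y < (p i).im → tfun i y = 1 := by
    intro i y hy1 hy2
    have hA : 1 ≤ (y - ((p i).im - ρ / 8)) / (ρ / 8 - 35 * δ) := by
      rw [le_div_iff₀ hρ8]; linarith
    have hB : 1 ≤ ((p i).im + ρ / 8 - y) / (ρ / 8) := by
      rw [le_div_iff₀ (by positivity)]; linarith
    show max 0 (min 1 (min ((y - ((p i).im - ρ / 8)) / (ρ / 8 - 35 * δ))
      (((p i).im + ρ / 8 - y) / (ρ / 8)))) = 1
    rw [min_eq_left (le_min hA hB), max_eq_right zero_le_one]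
  have ht_zero : ∀ i y, y ≤ (p i).im - ρ / 8 → tfun i y = 0 := by
    intro i y hy
    have hA : (y - ((p i).im - ρ / 8)) / (ρ / 8 - 35 * δ) ≤ 0 :=
      div_nonpos_of_nonpos_of_nonneg (by linarith) hρ8.le
    show max 0 (min 1 (min ((y - ((p i).im - ρ / 8)) / (ρ / 8 - 35 * δ))
      (((p i).im + ρ / 8 - y) / (ρ / 8)))) = 0
    exact max_eq_left ((min_le_right _ _).trans ((min_le_left _ _).trans hA))
  -- the window boxes lie in `B(p i, 7ρ/10)`
  have hbox : ∀ i (z : ℂ), |z.re - (p i).re| < 5 * ρ / 8 + 62 * δ → |z.im - (p i).im| < ρ / 8 + 62 * δ →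
      dist z (p i) < ρ := by
    intro i z hre him
    rw [dist_eq_norm, Complex.norm_def, Real.sqrt_lt' hρ, Complex.normSq_apply, Complex.sub_re,
      Complex.sub_im]
    have h1 : |z.re - (p i).re| < 687 / 1000 * ρ := by linarith
    have h2 : |z.im - (p i).im| < 187 / 1000 * ρ := by linarith
    have h1' := abs_lt.1 h1; have h2' := abs_lt.1 h2
    have hsq1 : (z.re - (p i).re) ^ 2 < (687 / 1000 * ρ) ^ 2 := sq_lt_sq' h1'.1 h1'.2
    have hsq2 : (z.im - (p i).im) ^ 2 < (187 / 1000 * ρ) ^ 2 := sq_lt_sq' h2'.1 h2'.2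
    nlinarith
  have hbox' : ∀ i (z : ℂ), |z.re - (p i).re| < 5 * ρ / 8 + 62 * δ → |z.im - (p i).im| < ρ / 8 →
      dist z (p i) < 7 * ρ / 10 := by
    intro i z hre him
    rw [dist_eq_norm, Complex.norm_def, Real.sqrt_lt' (by positivity), Complex.normSq_apply,
      Complex.sub_re, Complex.sub_im]
    have h1 : |z.re - (p i).re| < 687 / 1000 * ρ := by linarith
    have h1' := abs_lt.1 h1; have h2' := abs_lt.1 him
    have hsq1 : (z.re - (p i).re) ^ 2 < (687 / 1000 * ρ) ^ 2 := sq_lt_sq' h1'.1 h1'.2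
    have hsq2 : (z.im - (p i).im) ^ 2 < (ρ / 8) ^ 2 := sq_lt_sq' h2'.1 h2'.2
    nlinarith
  have hterm_pos : ∀ i (z : ℂ), 0 < sfun i z.re * tfun i z.im →
      |z.re - (p i).re| < 5 * ρ / 8 + 62 * δ ∧ |z.im - (p i).im| < ρ / 8 := by
    intro i z h
    have hs : 0 < sfun i z.re := by
      rcases (hs_nn i z.re).lt_or_eq with h' | h'
      · exact h'
      · rw [← h', zero_mul] at h; exact absurd h (lt_irrefl 0)
    have ht : 0 < tfun i z.im := by
      rcases (ht_nn i z.im).lt_or_eq with h' | h'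
      · exact h'
      · rw [← h', mul_zero] at h; exact absurd h (lt_irrefl 0)
    exact ⟨hs_pos i _ hs, ht_pos i _ ht⟩
  have hσ_nn : ∀ z, 0 ≤ σ z := fun z =>
    add_nonneg (mul_nonneg (hs_nn 0 _) (ht_nn 0 _)) (mul_nonneg (hs_nn 1 _) (ht_nn 1 _))
  have hterm_le : ∀ i (z : ℂ), sfun i z.re * tfun i z.im ≤ 31 * δ := fun i z =>
    calc sfun i z.re * tfun i z.im ≤ 31 * δ * 1 :=
          mul_le_mul (hs_le i _) (ht_le i _) (ht_nn i _) h31.le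
      _ = 31 * δ := mul_one _
  have hσ_le : ∀ z, σ z ≤ 62 * δ := fun z => by
    have := hterm_le 0 z; have := hterm_le 1 z
    show sfun 0 z.re * tfun 0 z.im + sfun 1 z.re * tfun 1 z.im ≤ 62 * δ
    linarith
  have hσ_ge : ∀ i z, sfun i z.re * tfun i z.im ≤ σ z := by
    intro i z
    have h0 := mul_nonneg (hs_nn 0 z.re) (ht_nn 0 z.im)
    have h1 := mul_nonneg (hs_nn 1 z.re) (ht_nn 1 z.im)
    fin_cases i
    · show sfun 0 z.re * tfun 0 z.im ≤ sfun 0 z.re * tfun 0 z.im + sfun 1 z.re * tfun 1 z.im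
      linarith
    · show sfun 1 z.re * tfun 1 z.im ≤ sfun 0 z.re * tfun 0 z.im + sfun 1 z.re * tfun 1 z.im
      linarith
  have hPdre : ∀ z, (Pd z).re = z.re := fun z => by simp [hPd]
  have hPdim : ∀ z, (Pd z).im = z.im - σ z := fun z => by simp [hPd]
  have hPd_of_zero : ∀ z, σ z = 0 → Pd z = z := fun z hz => by
    show z - ((σ z : ℝ) : ℂ) * Complex.I = z
    rw [hz]; simp
  -- a positive push happens inside one window box
  have hσ_pos : ∀ z, 0 < σ z → ∃ i, |z.re - (p i).re| < 5 * ρ / 8 + 62 * δ ∧ |z.im - (p i).im| < ρ / 8 := by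
    intro z hz
    by_contra hno
    push Not at hno
    have h0 : sfun 0 z.re * tfun 0 z.im = 0 := by
      rcases (mul_nonneg (hs_nn 0 z.re) (ht_nn 0 z.im)).lt_or_eq with h | h
      · obtain ⟨h1, h2⟩ := hterm_pos 0 z h; exact absurd h2 (not_lt.2 (hno 0 h1))
      · exact h.symm
    have h1 : sfun 1 z.re * tfun 1 z.im = 0 := by
      rcases (mul_nonneg (hs_nn 1 z.re) (ht_nn 1 z.im)).lt_or_eq with h | h
      · obtain ⟨h1, h2⟩ := hterm_pos 1 z h; exact absurd h2 (not_lt.2 (hno 1 h1))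
      · exact h.symm
    have : σ z = 0 := by
      show sfun 0 z.re * tfun 0 z.im + sfun 1 z.re * tfun 1 z.im = 0
      rw [h0, h1, add_zero]
    exact hz.ne' this
  have hPd_ball : ∀ z i, |z.re - (p i).re| < 5 * ρ / 8 + 62 * δ → |z.im - (p i).im| < ρ / 8 →
      Pd z ∈ ball (p i) ρ := by
    intro z i hre him
    rw [mem_ball]
    refine hbox i (Pd z) (by rw [hPdre]; exact hre) ?_
    rw [hPdim]
    have := hσ_nn z; have := hσ_le z
    have him' := abs_lt.1 him
    rw [abs_lt]; constructor <;> linarith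
  -- the exterior is pushed into the exterior
  have hPdE : ∀ z, z ∉ closure Ω → Pd z ∉ closure Ω := by
    intro z hz
    rcases (hσ_nn z).lt_or_eq with hpos | h0
    · obtain ⟨i, hre, him⟩ := hσ_pos z hpos
      have hzball : z ∈ ball (p i) ρ := (hbox' i z hre him).trans (by linarith)
      have hzim : z.im < (p i).im := im_lt_of_flat_of_exterior (hfl i) hzball hz
      refine not_mem_closure_of_flat (hfl i) (hPd_ball z i hre him) ?_
      rw [hPdim]; linarith [hσ_nn z]
    · rwa [hPd_of_zero z h0.symm]
  -- pushed exterior points absorbed by a disc are low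
  have hPdslab : ∀ z, z ∉ closure Ω → ∀ j, Pd z ∈ ball (p j) (5 * ρ / 8) →
      (Pd z).im ≤ (p j).im - 30 * δ := by
    intro z hz j hj
    have hjρ : Pd z ∈ ball (p j) ρ := ball_subset_ball (by linarith) hj
    have hre : |z.re - (p j).re| < 5 * ρ / 8 := by
      have h1 : |(Pd z - p j).re| ≤ ‖Pd z - p j‖ := Complex.abs_re_le_norm _
      rw [Complex.sub_re, hPdre] at h1
      exact h1.trans_lt (mem_ball_iff_norm.1 hj)
    have hsj : sfun j z.re = 31 * δ := hs_eq j _ (hre.trans (by linarith))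
    rcases (hσ_nn z).lt_or_eq with hpos | h0
    · obtain ⟨i, hrei, himi⟩ := hσ_pos z hpos
      have hiρ : Pd z ∈ ball (p i) ρ := hPd_ball z i hrei himi
      have hij : i = j := by
        by_contra hij
        have hd : dist (p i) (p j) < 2 * ρ :=
          calc dist (p i) (p j) ≤ dist (Pd z) (p i) + dist (Pd z) (p j) := dist_triangle_left _ _ _
            _ < ρ + ρ := add_lt_add (mem_ball.1 hiρ) (mem_ball.1 hjρ)
            _ = 2 * ρ := by ring
        have h01 : dist (p i) (p j) = dist (p 0) (p 1) := by
          fin_cases i <;> fin_cases j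
          · exact absurd rfl hij
          · rfl
          · exact dist_comm _ _
          · exact absurd rfl hij
        linarith
      subst hij
      have hzball : z ∈ ball (p i) ρ := (hbox' i z hrei himi).trans (by linarith)
      have hzim : z.im < (p i).im := im_lt_of_flat_of_exterior (hfl i) hzball hz
      rw [hPdim]
      rcases le_or_gt ((p i).im - 35 * δ) z.im with hhi | hlo
      · have ht1 : tfun i z.im = 1 := ht_one i _ hhi hzim
        have hge : 31 * δ ≤ σ z := by
          have := hσ_ge i z
          rw [hsj, ht1, mul_one] at this
          exact this
        linarith
      · linarith [hσ_nn z]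
    · have hPdz : Pd z = z := hPd_of_zero z h0.symm
      rw [hPdz] at hj hjρ ⊢
      have hzim : z.im < (p j).im := im_lt_of_flat_of_exterior (hfl j) hjρ hz
      have ht0 : tfun j z.im = 0 := by
        have h1 := hσ_ge j z
        rw [← h0, hsj] at h1
        have h2 : tfun j z.im ≤ 0 := by
          by_contra h3
          push Not at h3
          have : 0 < 31 * δ * tfun j z.im := mul_pos h31 h3
          linarith
        exact le_antisymm h2 (ht_nn j _)
      -- `tfun = 0` below the line forces `im z ≤ im (p j) - ρ/8`
      by_contra hgt
      push Not at hgt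
      have hA : 0 < (z.im - ((p j).im - ρ / 8)) / (ρ / 8 - 35 * δ) := div_pos (by linarith) hρ8
      have hB : 0 < ((p j).im + ρ / 8 - z.im) / (ρ / 8) := div_pos (by linarith) (by positivity)
      have hpos : 0 < tfun j z.im := by
        show 0 < max 0 (min 1 (min ((z.im - ((p j).im - ρ / 8)) / (ρ / 8 - 35 * δ))
          (((p j).im + ρ / 8 - z.im) / (ρ / 8))))
        exact lt_max_of_lt_right (lt_min one_pos (lt_min hA hB))
      rw [ht0] at hpos
      exact lt_irrefl _ hpos
  -- `Pd` fixes `e` and the far point `q`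
  have hfix : ∀ z : ℂ, (∀ i, dist z (p i) < 7 * ρ / 10 → z.im ≤ (p i).im - ρ / 8) → Pd z = z := by
    intro z hzlow
    apply hPd_of_zero
    have hterm0 : ∀ i, sfun i z.re * tfun i z.im = 0 := by
      intro i
      by_contra hne
      have hpos : 0 < sfun i z.re * tfun i z.im :=
        lt_of_le_of_ne (mul_nonneg (hs_nn i _) (ht_nn i _)) (Ne.symm hne)
      obtain ⟨hre, him⟩ := hterm_pos i z hpos
      have ht0 : tfun i z.im = 0 := ht_zero i _ (hzlow i (hbox' i z hre him))
      rw [ht0, mul_zero] at hpos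
      exact lt_irrefl _ hpos
    show sfun 0 z.re * tfun 0 z.im + sfun 1 z.re * tfun 1 z.im = 0
    rw [hterm0 0, hterm0 1, add_zero]
  -- continuity of the push
  have hPdc : Continuous Pd := by
    have hsc : ∀ i, Continuous (sfun i) := fun i => by
      show Continuous fun x => 31 * δ * max 0 (min 1 ((5 * ρ / 8 + 62 * δ - |x - (p i).re|) / (31 * δ)))
      fun_prop
    have htc : ∀ i, Continuous (tfun i) := fun i => by
      show Continuous fun y => max 0 (min 1 (min ((y - ((p i).im - ρ / 8)) / (ρ / 8 - 35 * δ))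
        (((p i).im + ρ / 8 - y) / (ρ / 8))))
      fun_prop
    have hσc : Continuous σ := by
      show Continuous fun z : ℂ => sfun 0 z.re * tfun 0 z.im + sfun 1 z.re * tfun 1 z.im
      fun_prop
    show Continuous fun z : ℂ => z - ((σ z : ℝ) : ℂ) * Complex.I
    fun_prop
  exact ⟨Pd, hPdc, hPdE, hfix, hPdslab⟩

/-- **Registered sub-goal `stub_carvedReduction_pushDown`** (crux item stmt-CriticalPhenomena-14005,
stub 5a4′ `stub_carvedReduction_squeeze`, piece (G4′a) PUSH-DOWN UNDER THE WINDOWS): registry form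
of `exists_pushDown`. -/
theorem stub_carvedReduction_pushDown :
    ∀ (Ω : Set ℂ) (ρ δ : ℝ) (p : Fin 2 → ℂ),
      (∀ i, Ω ∩ ball (p i) ρ = {z : ℂ | (p i).im < z.im} ∩ ball (p i) ρ) →
      2 * ρ ≤ dist (p 0) (p 1) → 0 < ρ → 0 < δ → 1000 * δ ≤ ρ →
      ∃ Pd : ℂ → ℂ, Continuous Pd ∧ (∀ z, z ∉ closure Ω → Pd z ∉ closure Ω) ∧
        (∀ z : ℂ, (∀ i, dist z (p i) < 7 * ρ / 10 → z.im ≤ (p i).im - ρ / 8) → Pd z = z) ∧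
        (∀ z, z ∉ closure Ω → ∀ j, Pd z ∈ ball (p j) (5 * ρ / 8) → (Pd z).im ≤ (p j).im - 30 * δ) :=
  fun _ _ _ _ hfl hsep hρ hδ hδρ => exists_pushDown hfl hsep hρ hδ hδρ

end Summit.CriticalPhenomena.SAWScalingLimit.Theorems.ObservableToSLER.Squeeze

end
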